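import Literature.NumberTheory.Automorphic.IntegratedOperatorSmoothVectors
import HarnessLib

/-!
# Non-vanishing of a local integrated operator on a vector with prescribed local component
(Gelbart, *Automorphic forms on adele groups* (1975), §10, pp. 151–153: the space
`M = ⊕_i {⊗_{v ∈ S} u_v} ⊗ {⊗_{v ∉ S} V^i_v}` cut out by the coefficients `f_v`, `v ∈ S`, is
non-zero on every constituent with `π^i_v ≅ π_v`; Jacquet–Langlands, LNM 114 (1970), §16, p. 503)

Topic `NumberTheory/Automorphic`; theorems only (no definition, no named fact, no instance). A
short consequence of `IntegratedOperatorSmoothVectors` recording, in the form consumed by the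
comparison of trace formulas, why the test function at a supercuspidal place does not kill the
relevant constituents. Let `Γ` be a group acting unitarily and strongly continuously on a Hilbert
space `H` (`π`), `G` a topological group with a homomorphism `ι : G →* Γ` (a local factor
`GL_n(K_w) ↪ GL_n(𝔸_K)`), `ρ` an abstract representation of `G` on `V` with a linear
`f : V → H` intertwining `ρ` and `π ∘ ι` (a local component, `HasLocalComponentAt`), `x ∈ V` a
smooth vector, `μ` a measure on `G` finite on compact sets and `ξ ∈ C_c(G)`:

* `apply_sum_setIntegral_smul_eq_integral` — for every linear form `ũ` on `V`, the Hecke sum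
  `h = Σ_{γ ∈ T} (∫_{γK} ξ dμ) • ρ(γ̃) x` (`K = Stab(x)`, `T` covering `supp ξ`) satisfies
  `ũ(h) = ∫ ξ(g) ũ(ρ(g) x) dμ(g)` (`integral_smul_eq_sum_setIntegral_smul` with `E = ℂ`).
* `integratedOperator_restrict_apply_ne_zero` — **if `f` is injective and
  `∫ ξ(g) ũ(ρ(g) x) dμ ≠ 0` for some linear form `ũ`, then `(π ∘ ι)(ξ) (f x) ≠ 0`**: by
  `integratedOperator_apply_eq_sum_of_intertwines`, `(π ∘ ι)(ξ)(f x) = f(h)` with `ũ(h) ≠ 0`.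
  With `SupercuspidalTestFunctions.exists_supercuspTestFunction` (which produces such `ξ`, `ũ`
  for a smooth supercuspidal `ρ` and any `x ≠ 0`) this is the non-vanishing of `R(ξ_w)` on a
  cuspidal constituent whose local component at `w` is `ρ` (irreducible `ρ`: every non-zero
  intertwiner is injective).

## References

* S. Gelbart, *Automorphic forms on adele groups*, Ann. of Math. Studies 83 (1975), §10,
  pp. 151–153 [Gelbart1975].
* H. Jacquet, R. P. Langlands, *Automorphic forms on `GL(2)`*, LNM 114 (1970), §16, p. 503
  [JacquetLanglands1970].
-/

noncomputable section

open MeasureTheory Measure Set Filter Topology CompactlySupported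
open scoped Pointwise

namespace Literature.NumberTheory.Automorphic

variable {G : Type*} [Group G] [TopologicalSpace G] [IsTopologicalGroup G] [MeasurableSpace G]
  [BorelSpace G]
  {Γ : Type*} [Group Γ]
  {H : Type*} [NormedAddCommGroup H] [InnerProductSpace ℂ H] [CompleteSpace H]
  {V : Type*} [AddCommGroup V] [Module ℂ V] {ρ : Representation ℂ G V}

/-- **Linear forms turn the Hecke sum into an integral**: for a smooth vector `x` (open
stabiliser `K`), `ξ : G → ℂ` continuous with compact support, a finite set `T` of cosets of `K`
covering the support of `ξ` and a linear form `ũ`,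
`ũ (Σ_{γ ∈ T} (∫_{γK} ξ dμ) • ρ(γ̃) x) = ∫ ξ(g) ũ(ρ(g) x) dμ(g)` — the scalar function
`g ↦ ũ(ρ(g) x)` being right-`K`-invariant. [folklore] -/
theorem apply_sum_setIntegral_smul_eq_integral (μ : Measure G) [IsFiniteMeasureOnCompacts μ]
    {x : V} (hx : ρ.IsSmoothVector x) {ξ : G → ℂ} (hξ : Continuous ξ) (hξs : HasCompactSupport ξ)
    {T : Finset (G ⧸ ρ.stabilizerSubgroup x)}
    (hT : tsupport ξ ⊆ ⋃ γ ∈ T, {g : G | (g : G ⧸ ρ.stabilizerSubgroup x) = γ})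
    (ut : Module.Dual ℂ V) :
    ut (∑ γ ∈ T, (∫ g in {g : G | (g : G ⧸ ρ.stabilizerSubgroup x) = γ}, ξ g ∂μ) • ρ γ.out x) =
      ∫ g, ξ g * ut (ρ g x) ∂μ := by
  have hF : ∀ g : G, ∀ k ∈ ρ.stabilizerSubgroup x, ut (ρ (g * k) x) = ut (ρ g x) := by
    intro g k hk
    rw [map_mul, Module.End.mul_apply, (ρ.mem_stabilizerSubgroup x k).1 hk]
  have h := integral_smul_eq_sum_setIntegral_smul (E := ℂ) (μ := μ)
    (F := fun g => ut (ρ g x)) hx hF hξ hξs hT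
  simp only [smul_eq_mul] at h
  rw [h, _root_.map_sum]
  refine Finset.sum_congr rfl fun γ _ => ?_
  rw [map_smul, smul_eq_mul]

/-- **Non-vanishing of the local integrated operator on a vector with prescribed local component**
(Gelbart (1975), §10, pp. 151–153; Jacquet–Langlands (1970), p. 503). Let `π` be a unitary
strongly continuous representation of `Γ` on a Hilbert space, `ι : G →* Γ`, `ρ` a representation
of `G` on `V`, `f : V → H` an **injective** linear map with `f (ρ g y) = π (ι g) (f y)`, `x ∈ V`
a smooth vector and `ξ ∈ C_c(G)` with `∫ ξ(g) ũ(ρ(g) x) dμ ≠ 0` for some linear form `ũ`. Then the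
integrated operator of the restricted representation `π ∘ ι` does not kill `f x`:
`(π ∘ ι)(ξ) (f x) ≠ 0`. [cite: Gelbart1975, §10 pp. 151–153] -/
theorem integratedOperator_restrict_apply_ne_zero {π : ContRepresentation ℂ Γ H} (ι : G →* Γ)
    (hu : (π.restrict ι).IsUnitary) (hc : (π.restrict ι).IsStronglyContinuous)
    (μ : Measure G) [IsFiniteMeasureOnCompacts μ]
    (f : V →ₗ[ℂ] H) (hf : ∀ (g : G) (y : V), f (ρ g y) = π (ι g) (f y))
    (hfi : Function.Injective f) {x : V} (hx : ρ.IsSmoothVector x) (ξ : C_c(G, ℂ))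
    (ut : Module.Dual ℂ V) (hne : ∫ g, ξ g * ut (ρ g x) ∂μ ≠ 0) :
    (π.restrict ι).integratedOperator hu hc μ ξ (f x) ≠ 0 := by
  have hf' : ∀ (g : G) (y : V), f (ρ g y) = (π.restrict ι) g (f y) := fun g y => by
    rw [hf]; rfl
  obtain ⟨T, hT⟩ := exists_finset_tsupport_subset_biUnion_coset (ρ.stabilizerSubgroup x) hx
    ξ.hasCompactSupport
  rw [ContRepresentation.integratedOperator_apply_eq_sum_of_intertwines hu hc μ f hf' hx ξ hT,
    ← map_zero f, hfi.ne_iff]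
  intro h0
  apply hne
  rw [← apply_sum_setIntegral_smul_eq_integral μ hx (ξ := (ξ : G → ℂ)) ξ.continuous
    ξ.hasCompactSupport hT ut, h0, map_zero]

end Literature.NumberTheory.Automorphic
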